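/-
Copyright (c) 2026 the pub-hodgecm-mathlib formalisation cell (harness21).  Prover seat hodgecm-mathlib-LH4-p06 (g7), req620 Track A «(D-RAM) FOUR-FRAME» squad, helper lane
on h413 = stmt-HodgeConjecture-24833 (count-neutral).  STAGE-1b (H-sq) ASSEMBLY, GUARDED form (A′) (★ p859542 re-threaded: REF5 R5-282 (4) ∕ LH4-p14 (g6) 11:37:57Z ∕ LH4-r01 BOX MT).  2026-09-04.
-/
import Summits.HodgeConjecture.HodgeConjecture.Theorems.F0P3cDyRamPieceRowOneTokenVehicles     -- ★ p859064 (LH4-p14 (g6)): (V1) `rowOne_of_hSideIdentity_token` (row (1) from the sign-free identity, amplitude letter `A`)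
import Summits.HodgeConjecture.HodgeConjecture.Theorems.F0P3cDyRamHSideTransvPlusGuarded     -- ★ p859874 (LH4-p14 (g6)) §1: the GUARDED `hSideIdentity_hFamily_coefAffine_of_affine_token` (identity for `hFamily` at coefAffine(cA,cB), hA asked under the root guards)
import Summits.HodgeConjecture.HodgeConjecture.Theorems.F0P3cDyRamHSideSqOfHFamilyRows        -- ★ p859542 (LH4-p06 (g6)) §1: `indicator_levels_zero_eq_sqLevel` (on `K` the two-level piece at `a = 0` is the square-level piece)
import Summits.HodgeConjecture.HodgeConjecture.Theorems.F0P3cDyRamPieceTypeTwoRowVehicle       -- ★ (LH4-p14 (g6)): (V6) `rowTwo_of_gSide_hFamily` (row (2) of ANY piece from its type-(2) census in X-currency)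
import Summits.HodgeConjecture.HodgeConjecture.Theorems.F0P3cDyRamLevelsLeviRowScalar          -- ★ (LH4-p14 (g6) over LH4-p08 (g7)): (V5-lev) `rowThree_levels_hFamily_of_scalar` (row (3) of `𝟙_{K_{a,b}}`)
import Summits.HodgeConjecture.HodgeConjecture.Theorems.F0P3cDyRamHFamilySmooth                -- ★ p854867: `isLocSmooth_hFamily`
import Summits.HodgeConjecture.HodgeConjecture.Theorems.F0P3cDyRamDOfPlaceOfDatum              -- ★ `dOfPlace_eq_of_isRamifiedQuadraticDatum`
import Literature.NumberTheory.Automorphic.CMLocalUnipotentHaarMeasure                        -- ★ p859505 (LH4-p06 (g6)): `exists_isHaarMeasure_sFinite_unipotentU` (the `μN` witness)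
import HarnessLib

/-!
# Crux `H413`, line LH4 «(D-RAM) FOUR-FRAME» — THE (H-sq) ASSEMBLY, GUARDED (form (A′)): the H-side closed-form triple of the SQUARE-LEVEL piece `𝟙{u ∈ K ∣ X² ∈ ϖ^{ℓb(d)} M₃}` (★ p859209
# (V-sq)'s `hH` ∕ the directive's `HSideSqTripleS shift Ω N₀ ℓb A`) for `ψ := hFamily`, `coef := coefAffine(cA, cB)`, FROM THREE PER-PLACE LETTERS — the twin of ★ p859526

Cell `hodgecm-mathlib` (D-0151), FLOOR 0, crux item H413 = `stmt-HodgeConjecture-24833`, route `HCCMUnconditional`; squad F0∕P3c∕LH4.  THEOREMS ONLY (one theorem; no `def`,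
no instance, no notation, no `sorry`, default heartbeats); ★ imports only; lane `--supports stmt-HodgeConjecture-24833 --as helper`.  COUNT-NEUTRAL: every letter is a HYPOTHESIS;
the tier-0 row `stub_rows_regular` and the directive's stub `stub_hside_sq` stay OPEN until the letters' producers exist.

WHY THIS EDITION (form (A′)).  ★ p859542 asked its row-(1) letter `hA` on ALL norm-one roots `a, b` of the element datum; at the sign token of record `Ω := omegaR` that
letter is UNSATISFIABLE (LH4-p14 (g6) 11:37:57Z ∕ LH4-r01 BOX MT ∕ REF5 R5-282: `omegaR … a b 2 = glueSign (b∕a)` flips under `a ↦ −a` wherever `−1` is a non-norm, e.g. at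
`(ℚ(i), 1+i)`, forcing the amplitude to vanish).  The consumer — row (1) of ★ DEFS №5 `HSideSqTripleS` — only ever instantiates `hA` at roots carrying the guards
`|a − 1|_w < |2|_w`, `|b − 1|_w < |2|_w` (its binders `_ha1 _hb1`), so the honest letter is the GUARDED one; this file is ★ p859542 §2 with exactly that letter (two tokens more in
`hrows`, conclusion BYTE-IDENTICAL), row (1) now riding on ★ p859874 §1 (LH4-p14 (g6)) which hands the consumer's guards to `hA`; §1 of ★ p859542 is imported.

WHAT.  Dealer LH4-plan (g13) D-1b draft v1 §1∕§3: the new tier-0 stub `stub_hside_sq : HSideSqTripleS shiftR omegaR depthOfRecord mstarOfRecord amplSq` is the `hH` letter of ★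
p859234 `pieceRowsWild_gselStar_three_of_fencedLaw_of_hside` — the text of ★ p859209 (V-sq)'s `hH` for the piece `𝟙{u ∈ K ∣ X² ∈ ϖ^{ℓb(d)}M₃}`.  THIS FILE builds it exactly as
★ p859526 `hSideLevels_hFamily_of_rows` builds the levels triple: ROW (1) = ★ (V1) `rowOne_of_hSideIdentity_token` ∘ ★ `hSideIdentity_hFamily_coefAffine_of_affine_token` at
`C := νG₃(K).toReal` from the affine-token letter **`hA`**; ROW (2) = ★ (V6) `rowTwo_of_gSide_hFamily` at `F :=` the square-level piece from its type-(2) census letter **`hG₂`**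
(X-currency; organs LH4-p07 (g8) ∕ LH4-p04 (g7)); ROW (3) = ★ (V5-lev) `rowThree_levels_hFamily_of_scalar` AT `(a, b) = (0, ℓb d)` from the Levi scalar letter **`hnum`** (organ
LH4-p08 (g7); `μN` from ★ p859505), transported along §1 **`indicator_levels_zero_eq_sqLevel`**: ON `K` THE TWO-LEVEL PIECE AT `a = 0` IS THE SQUARE-LEVEL PIECE as functions on
`G′_v` (`u ∈ K ⇒ ι_w u ∈ M₃(𝒪_w)`, ★ `mem_cmLocalIntegralLevel_iff_isIntMatrix`, so `X = ι_w u − 1 ∈ ϖ^0 M₃`; ★ p859029 `setOf_levels_zero_eq_setOf_sqLevel` is the vertex-count twin).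
So **`hSideSq_hFamily_of_rows (shift Ω N₀ ℓb A) (hb) (hrows) :` ★ p859209 (V-sq)'s `hH`** where `hrows` = per place `∃ cA cB N₁, hA ∧ hG₂ ∧ hnum`; composing with ★ p859209∕p859234
reaches the tier-0 row type `PieceRowsWild gselStar 3`.
HONEST LABEL.  Count-neutral (`--supports`); pays no registered stub, touches no `Lines/` module; `HC_CM` is proved only modulo the 7 printed citations (2 remaining named inputs:
hLiu418 = `stmt-HodgeConjecture-24832`, h413 = `stmt-HodgeConjecture-24833`) until rung 0 closes.

## References
* [Rogawski1990] J. D. Rogawski, *Automorphic Representations of Unitary Groups in Three Variables*, Ann. of Math. Stud. 123 (1990): §4.3 (4.3.1) p. 43; §4.9 Prop. 4.9.1 (a)(b) p. 55, Lemma 4.9.2∕4.9.3 p. 56.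
* [LanglandsShelstad1987] R. P. Langlands, D. Shelstad, *On the definition of transfer factors*, Math. Ann. 278 (1987), §1.3, §3.
* [LabesseLanglands1979] J.-P. Labesse, R. P. Langlands, *L-indistinguishability for SL(2)*, Canad. J. Math. 31 (1979), §2 (2.2).
* [Kottwitz1986BaseChangeUnits] R. E. Kottwitz, *Base change for unit elements of Hecke algebras*, Compositio Math. 60 (1986), §1 pp. 240–241.
-/

set_option autoImplicit false

noncomputable section

namespace Summit.HodgeConjecture.HodgeConjecture.Cruxes.H413.F0P3cDyRamHSideSqOfHFamilyRowsGuarded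

open MeasureTheory Measure NumberField IsDedekindDomain Topology Filter
open Literature.NumberTheory.Automorphic Literature.NumberTheory.Automorphic.UnitaryGroup Literature.NumberTheory.Automorphic.IntegralReduction
open Literature.NumberTheory.Automorphic.UnitaryLatticeTree Literature.NumberTheory.Automorphic.HermitianLattice
open Literature.NumberTheory.Rogawski1990 Literature.NumberTheory.GaloisRepresentations
open Literature.MeasureTheory.Group (descConj)
open scoped Matrix MatrixGroups Classical ValuativeRel WithZero
open Literature.NumberTheory.Automorphic.UnitaryThreeFourFrame
open Summit.HodgeConjecture.HodgeConjecture.Cruxes.H413.F0P3cDyRamFourFrameLawDefs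
open Summit.HodgeConjecture.HodgeConjecture.Cruxes.H413.F0P3cDyRamFourFrameLawDefsR
open Summit.HodgeConjecture.HodgeConjecture.Cruxes.H413.F0P3cDyRamFourFrameLawDefsR2
open Summit.HodgeConjecture.HodgeConjecture.Cruxes.H413.F0P3cDyRamFourFrameHSideDefs
open Summit.HodgeConjecture.HodgeConjecture.Cruxes.H413.F0P3cDyRamFourFrameHSideDefsR
open Summit.HodgeConjecture.HodgeConjecture.Cruxes.H413.F0P3cDyRamFourFrameCensusDefs
open Summit.HodgeConjecture.HodgeConjecture.Cruxes.H413.F0P3cDyRamFourFramePieces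
open Summit.HodgeConjecture.HodgeConjecture.Cruxes.H413.F0P3cDyRamFourFrameHFamilyDefs
open Summit.HodgeConjecture.HodgeConjecture.Cruxes.H413.F0P3cDyRamHFamilySmooth
open Summit.HodgeConjecture.HodgeConjecture.Cruxes.H413.F0P3cDyRamWildPlaceDatum
open Summit.HodgeConjecture.HodgeConjecture.Cruxes.H413.F0P3cDyRamDOfPlaceOfDatum
open Summit.HodgeConjecture.HodgeConjecture.Cruxes.H413.F0P3cDyRamPieceRowOneTokenVehicles
open Summit.HodgeConjecture.HodgeConjecture.Cruxes.H413.F0P3cDyRamHSideTransvPlusGuarded (hSideIdentity_hFamily_coefAffine_of_affine_token)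
open Summit.HodgeConjecture.HodgeConjecture.Cruxes.H413.F0P3cDyRamHSideSqOfHFamilyRows (indicator_levels_zero_eq_sqLevel)
open Summit.HodgeConjecture.HodgeConjecture.Cruxes.H413.F0P3cDyRamPieceTypeTwoRowVehicle
open Summit.HodgeConjecture.HodgeConjecture.Cruxes.H413.F0P3cDyRamLevelsLeviRowScalar
open Summit.HodgeConjecture.HodgeConjecture.Cruxes.H413.F0P3cDyRamFourFrameCensusDefs
open Summit.HodgeConjecture.HodgeConjecture.Cruxes.H413.F0P3cDyRamProfileLevelClass

/-! §1 of ★ p859542 (`indicator_levels_zero_eq_sqLevel`) is IMPORTED, not restated. -/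

/-- **THE (H-sq) ASSEMBLY `hSideSq_hFamily_of_rows`, GUARDED** (★ p859542 verbatim except the two ROOT GUARDS `|a − 1|_w < |2|_w → |b − 1|_w < |2|_w →` in the hA letter of `hrows` = form (A′); row (1) over ★ p859874 §1 instead of ★ p859212).  For a level schedule `ℓb : ℕ → ℕ` of the datum with `ℓb d ≤ m*(d)` (`d ≥ 1`), a sign schedule `Ω`, an amplitude letter
`A` and per-place letters `hrows` = `∃ cA cB N₁, hA ∧ hG₂ ∧ hnum` (row (1) affine token, row (2) type-(2) census of the square-level piece in X-currency, row (3) Levi scalar of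
`𝟙_{K_{0,ℓb}}` — all at `coefAffine(cA, cB)`): ★ p859209 (V-sq)'s H-side triple `hH` for `𝟙{u ∈ K ∣ X² ∈ ϖ^{ℓb(d)}M₃}` with `ψ := hFamily`, i.e. the directive's
`HSideSqTripleS shift Ω N₀ ℓb A`.  Row (3) is ★ (V5-lev) at `(0, ℓb d)` transported along `indicator_levels_zero_eq_sqLevel`.
[cite: Rogawski1990, §4.9 Prop. 4.9.1 (a)(b) p. 55, Lemma 4.9.3 p. 56; §4.3 (4.3.1) p. 43] [cite: LanglandsShelstad1987, §1.3, §3] [cite: LabesseLanglands1979, §2 (2.2)] -/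
theorem hSideSq_hFamily_of_rows (shift : ℕ → ℕ → ℤ) (Ω : OmegaSchedule) (N₀ : ℕ → ℕ) (ℓb : ℕ → ℕ) (A : ℕ → ℕ → ℕ → ℕ → ℤ → ℚ)
    (hb : ∀ d : ℕ, 1 ≤ d → ℓb d ≤ mstarOfRecord d)
    (hrows :
      ∀ (L : Type) [Field L] [NumberField L] [IsCMField L]
        {v : HeightOneSpectrum (𝓞 ↥(maximalRealSubfield L))} (w : UnitaryGroup.PlacesOver L v)
        (hw : IsCMField.complexConj L • w.1 = w.1) (_he : v.asIdeal.ramificationIdx' w.1.asIdeal ≠ 1)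
        (_h2 : ¬ IsUnit (2 : 𝒪[w.1.adicCompletion L]))
        (ϖ : (w.1.adicCompletion L)) (_hϖ : Valued.v ϖ = WithZero.exp (-1 : ℤ)) (d tE : ℕ) (_hD : IsRamifiedQuadraticDatum (galAdicCompletionMap (L := L) (IsCMField.complexConj L) hw) ϖ d tE)
        [Fintype (Valued.ResidueField (w.1.adicCompletion L))] (δ : (w.1.adicCompletion L)) (_hδ : (galAdicCompletionMap (L := L) (IsCMField.complexConj L) hw) δ = -δ) (_hδ0 : δ ≠ 0)
        (μ : HeckeCharacter L) (_hμu : μ.IsUnitary)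
        (_hμω : ∀ x : ideleGroup ↥(maximalRealSubfield L), μ (AdeleRing.ideleBaseChange ↥(maximalRealSubfield L) L x) = quadraticHeckeCharCM L x)
        [MeasurableSpace ((UnitaryGroup.cmDatum L 3 (Matrix.of fun i j : Fin 3 => if i.val + j.val + 1 = 3 then (1 : L) else 0)).Local v)] [BorelSpace ((UnitaryGroup.cmDatum L 3 (Matrix.of fun i j : Fin 3 => if i.val + j.val + 1 = 3 then (1 : L) else 0)).Local v)]
        [∀ γ : ((UnitaryGroup.cmDatum L 3 (Matrix.of fun i j : Fin 3 => if i.val + j.val + 1 = 3 then (1 : L) else 0)).Local v), MeasurableSpace (((UnitaryGroup.cmDatum L 3 (Matrix.of fun i j : Fin 3 => if i.val + j.val + 1 = 3 then (1 : L) else 0)).Local v) ⧸ Subgroup.centralizer ({γ} : Set ((UnitaryGroup.cmDatum L 3 (Matrix.of fun i j : Fin 3 => if i.val + j.val + 1 = 3 then (1 : L) else 0)).Local v)))]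
        [∀ γ : ((UnitaryGroup.cmDatum L 3 (Matrix.of fun i j : Fin 3 => if i.val + j.val + 1 = 3 then (1 : L) else 0)).Local v), BorelSpace (((UnitaryGroup.cmDatum L 3 (Matrix.of fun i j : Fin 3 => if i.val + j.val + 1 = 3 then (1 : L) else 0)).Local v) ⧸ Subgroup.centralizer ({γ} : Set ((UnitaryGroup.cmDatum L 3 (Matrix.of fun i j : Fin 3 => if i.val + j.val + 1 = 3 then (1 : L) else 0)).Local v)))]
        [MeasurableSpace ((UnitaryGroup.cmDatum L 2 (Matrix.of fun i j : Fin 2 => if i.val + j.val + 1 = 2 then (1 : L) else 0)).Local v × (UnitaryGroup.cmDatum L 1 (Matrix.of fun i j : Fin 1 => if i.val + j.val + 1 = 1 then (1 : L) else 0)).Local v)] [BorelSpace ((UnitaryGroup.cmDatum L 2 (Matrix.of fun i j : Fin 2 => if i.val + j.val + 1 = 2 then (1 : L) else 0)).Local v × (UnitaryGroup.cmDatum L 1 (Matrix.of fun i j : Fin 1 => if i.val + j.val + 1 = 1 then (1 : L) else 0)).Local v)]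
        [∀ a : ((UnitaryGroup.cmDatum L 2 (Matrix.of fun i j : Fin 2 => if i.val + j.val + 1 = 2 then (1 : L) else 0)).Local v × (UnitaryGroup.cmDatum L 1 (Matrix.of fun i j : Fin 1 => if i.val + j.val + 1 = 1 then (1 : L) else 0)).Local v), MeasurableSpace (((UnitaryGroup.cmDatum L 2 (Matrix.of fun i j : Fin 2 => if i.val + j.val + 1 = 2 then (1 : L) else 0)).Local v × (UnitaryGroup.cmDatum L 1 (Matrix.of fun i j : Fin 1 => if i.val + j.val + 1 = 1 then (1 : L) else 0)).Local v) ⧸ Subgroup.centralizer ({a} : Set ((UnitaryGroup.cmDatum L 2 (Matrix.of fun i j : Fin 2 => if i.val + j.val + 1 = 2 then (1 : L) else 0)).Local v × (UnitaryGroup.cmDatum L 1 (Matrix.of fun i j : Fin 1 => if i.val + j.val + 1 = 1 then (1 : L) else 0)).Local v)))]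
        [∀ a : ((UnitaryGroup.cmDatum L 2 (Matrix.of fun i j : Fin 2 => if i.val + j.val + 1 = 2 then (1 : L) else 0)).Local v × (UnitaryGroup.cmDatum L 1 (Matrix.of fun i j : Fin 1 => if i.val + j.val + 1 = 1 then (1 : L) else 0)).Local v), BorelSpace (((UnitaryGroup.cmDatum L 2 (Matrix.of fun i j : Fin 2 => if i.val + j.val + 1 = 2 then (1 : L) else 0)).Local v × (UnitaryGroup.cmDatum L 1 (Matrix.of fun i j : Fin 1 => if i.val + j.val + 1 = 1 then (1 : L) else 0)).Local v) ⧸ Subgroup.centralizer ({a} : Set ((UnitaryGroup.cmDatum L 2 (Matrix.of fun i j : Fin 2 => if i.val + j.val + 1 = 2 then (1 : L) else 0)).Local v × (UnitaryGroup.cmDatum L 1 (Matrix.of fun i j : Fin 1 => if i.val + j.val + 1 = 1 then (1 : L) else 0)).Local v)))]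
        (νH : Measure ((UnitaryGroup.cmDatum L 2 (Matrix.of fun i j : Fin 2 => if i.val + j.val + 1 = 2 then (1 : L) else 0)).Local v × (UnitaryGroup.cmDatum L 1 (Matrix.of fun i j : Fin 1 => if i.val + j.val + 1 = 1 then (1 : L) else 0)).Local v)) [νH.IsHaarMeasure] [νH.IsMulRightInvariant]
        (νG₃ : Measure ((UnitaryGroup.cmDatum L 3 (Matrix.of fun i j : Fin 3 => if i.val + j.val + 1 = 3 then (1 : L) else 0)).Local v)) [νG₃.IsHaarMeasure] [νG₃.IsMulRightInvariant]
        (mH : OrbitalMeasureFamily ((UnitaryGroup.cmDatum L 2 (Matrix.of fun i j : Fin 2 => if i.val + j.val + 1 = 2 then (1 : L) else 0)).Local v × (UnitaryGroup.cmDatum L 1 (Matrix.of fun i j : Fin 1 => if i.val + j.val + 1 = 1 then (1 : L) else 0)).Local v)) (mG₃ : OrbitalMeasureFamily ((UnitaryGroup.cmDatum L 3 (Matrix.of fun i j : Fin 3 => if i.val + j.val + 1 = 3 then (1 : L) else 0)).Local v))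
        (_hmH : mH.IsCanonical (IsLocalGRegular L v) νH) (_hmG : mG₃.IsCanonical (fun γ => IsRegularElt (γ.val : GL (Fin 3) (UnitaryGroup.LocalRing L v))) νG₃),
        ∃ (cA cB : ℂ) (N₁ : ℕ),
          -- ROW (1) LETTER (hA), GUARDED form (A′): as for the level pieces (★ p859874 §1 `hSideIdentity_hFamily_coefAffine_of_affine_token` binder at `C := νG₃(K).toReal`)
          (∀ (a b : (w.1.adicCompletion L)) (n₁ n₂ n₃ k : ℕ) (i : Fin 3) (B : ℤ),
        a * (galAdicCompletionMap (L := L) (IsCMField.complexConj L) hw) a = 1 → b * (galAdicCompletionMap (L := L) (IsCMField.complexConj L) hw) b = 1 →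
        Valued.v (a - 1) < Valued.v (2 : (w.1.adicCompletion L)) → Valued.v (b - 1) < Valued.v (2 : (w.1.adicCompletion L)) →
        IsElementDatum (galAdicCompletionMap (L := L) (IsCMField.complexConj L) hw) ϖ (N₀ d) (a * a) (b * b) n₁ n₂ n₃ →
        2 * ((n₁ + n₂) / 2) = n₁ + n₂ → 2 * k + d = n₁ + n₂ + n₃ + 2 → 2 * B = ((![n₁, n₂, n₃] : Fin 3 → ℕ) i : ℤ) - d + 2 - 2 * shift d tE → i = 2 →
        N₁ ≤ n₃ → (n₃ + d) % 2 = 0 →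
        ((νG₃ (cmLocalIntegralLevel L 3 (Matrix.of fun i j : Fin 3 => if i.val + j.val + 1 = 3 then (1 : L) else 0) v : Set ((UnitaryGroup.cmDatum L 3 (Matrix.of fun i j : Fin 3 => if i.val + j.val + 1 = 3 then (1 : L) else 0)).Local v))).toReal : ℂ) * ((Fintype.card (Valued.ResidueField (w.1.adicCompletion L)) : ℂ) ^ ((n₁ + n₂) / 2))⁻¹ * (((Ω (w.1.adicCompletion L) (galAdicCompletionMap (L := L) (IsCMField.complexConj L) hw) ϖ d a b i : ℤ) : ℂ) * ((A (Fintype.card (Valued.ResidueField (w.1.adicCompletion L))) d tE k B : ℚ) : ℂ)) =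
          cA * (((2 * ((Fintype.card (Valued.ResidueField (w.1.adicCompletion L)) : ℚ) ^ (((n₃ - d) / 2 : ℕ) + 1) - 1) / ((Fintype.card (Valued.ResidueField (w.1.adicCompletion L)) : ℚ) - 1) : ℚ)) : ℂ) + cB) ∧
          -- ROW (2) LETTER (hG₂): the type-(2) census of the SQUARE-LEVEL piece in X-currency at coefAffine(cA, cB) (★ (V6))
          (∃ V ∈ 𝓝 (1 : ((UnitaryGroup.cmDatum L 2 (Matrix.of fun i j : Fin 2 => if i.val + j.val + 1 = 2 then (1 : L) else 0)).Local v × (UnitaryGroup.cmDatum L 1 (Matrix.of fun i j : Fin 1 => if i.val + j.val + 1 = 1 then (1 : L) else 0)).Local v)), ∀ γH ∈ V, IsLocalGRegular L v γH →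
        ¬ (∃ x : (w.1.adicCompletion L), (((((γH).1.val : GL (Fin 2) (UnitaryGroup.LocalRing L v)).val.map (Pi.evalRingHom (fun w' : UnitaryGroup.PlacesOver L v => w'.1.adicCompletion L) w))).charpoly).IsRoot x) →
        ∀ X : ℂ, (∀ s : Fin 2, stableOrbitalIntegralRel (IsLocalStablyConjH L v) mH (hFamily L w hw ϖ s) γH = (νH.real (Function.support (hFamily L w hw ϖ s)) : ℂ) * X + (if ((s : Fin 2) : ℕ) = d % 2 then (0 : ℂ) else -2 * (νH.real (Function.support (hFamily L w hw ϖ s)) : ℂ)) / 2) →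
          ∑ᶠ c : ConjClasses ((UnitaryGroup.cmDatum L 3 (Matrix.of fun i j : Fin 3 => if i.val + j.val + 1 = 3 then (1 : L) else 0)).Local v), ((finExplicitCollection L (Matrix.of fun i j : Fin 3 => if i.val + j.val + 1 = 3 then (1 : L) else 0) μ (finExplicitDelta_conj_left_all L (Matrix.of fun i j : Fin 3 => if i.val + j.val + 1 = 3 then (1 : L) else 0) μ) (finExplicitDelta_conj_right_all L (Matrix.of fun i j : Fin 3 => if i.val + j.val + 1 = 3 then (1 : L) else 0) μ)) v).Δ γH (Quotient.out c) * classOrbitalIntegral mG₃ (Set.indicator {u : ((UnitaryGroup.cmDatum L 3 (Matrix.of fun i j : Fin 3 => if i.val + j.val + 1 = 3 then (1 : L) else 0)).Local v) | u ∈ cmLocalIntegralLevel L 3 (Matrix.of fun i j : Fin 3 => if i.val + j.val + 1 = 3 then (1 : L) else 0) v ∧ InLevel ϖ (ℓb (dOfPlace L v w)) ((wMatrix L w hw u - 1) * (wMatrix L w hw u - 1))} (fun _ => (1 : ℂ))) c =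
            ((fun s : Fin 2 => if ((s : Fin 2) : ℕ) = d % 2 then (cA + cB) / (2 * (νH.real (Function.support (hFamily L w hw ϖ s)) : ℂ)) else -cB / (2 * (νH.real (Function.support (hFamily L w hw ϖ s)) : ℂ))) 0 * (νH.real (Function.support (hFamily L w hw ϖ 0)) : ℂ) + (fun s : Fin 2 => if ((s : Fin 2) : ℕ) = d % 2 then (cA + cB) / (2 * (νH.real (Function.support (hFamily L w hw ϖ s)) : ℂ)) else -cB / (2 * (νH.real (Function.support (hFamily L w hw ϖ s)) : ℂ))) 1 * (νH.real (Function.support (hFamily L w hw ϖ 1)) : ℂ)) * X + ((fun s : Fin 2 => if ((s : Fin 2) : ℕ) = d % 2 then (cA + cB) / (2 * (νH.real (Function.support (hFamily L w hw ϖ s)) : ℂ)) else -cB / (2 * (νH.real (Function.support (hFamily L w hw ϖ s)) : ℂ))) 0 * (if ((0 : Fin 2) : ℕ) = d % 2 then (0 : ℂ) else -2 * (νH.real (Function.support (hFamily L w hw ϖ 0)) : ℂ)) + (fun s : Fin 2 => if ((s : Fin 2) : ℕ) = d % 2 then (cA + cB) / (2 * (νH.real (Function.support (hFamily L w hw ϖ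 s)) : ℂ)) else -cB / (2 * (νH.real (Function.support (hFamily L w hw ϖ s)) : ℂ))) 1 * (if ((1 : Fin 2) : ℕ) = d % 2 then (0 : ℂ) else -2 * (νH.real (Function.support (hFamily L w hw ϖ 1)) : ℂ))) / 2) ∧
          -- ROW (3) LETTER (hnum): the Levi scalar of `𝟙_{K_{0, ℓb}}` (= the square-level piece on `K`) at coefAffine(cA, cB) (★ (V5-lev) at `a = 0`)
          ((fun s : Fin 2 => if ((s : Fin 2) : ℕ) = d % 2 then (cA + cB) / (2 * (νH.real (Function.support (hFamily L w hw ϖ s)) : ℂ)) else -cB / (2 * (νH.real (Function.support (hFamily L w hw ϖ s)) : ℂ))) 0 * (νH.real (Function.support (hFamily L w hw ϖ 0)) : ℂ) + (fun s : Fin 2 => if ((s : Fin 2) : ℕ) = d % 2 then (cA + cB) / (2 * (νH.real (Function.support (hFamily L w hw ϖ s)) : ℂ)) else -cB / (2 * (νH.real (Function.support (hFamily L w hw ϖ s)) : ℂ))) 1 * (νH.real (Function.support (hFamily L w hw ϖ 1)) : ℂ) =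
          ((((Ideal.absNorm v.asIdeal : ℝ) ^ ((max (max 0 (((ℓb (dOfPlace L v w)) + 1) / 2)) ((0 + d) / 2) - d / 2) + (0 - d % 2 + 1) / 2))⁻¹) : ℂ) *
          (((νG₃.real (cmLocalIntegralLevel L 3 (Matrix.of fun i j : Fin 3 => if i.val + j.val + 1 = 3 then (1 : L) else 0) v : Set ((cmDatum L 3 (Matrix.of fun i j : Fin 3 => if i.val + j.val + 1 = 3 then (1 : L) else 0)).Local v)) : ℂ) /
            (νH.real ((((cmLocalIntegralLevel L 2 (Matrix.of fun i j : Fin 2 => if i.val + j.val + 1 = 2 then (1 : L) else 0) v).prod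
              (cmLocalIntegralLevel L 1 (Matrix.of fun i j : Fin 1 => if i.val + j.val + 1 = 1 then (1 : L) else 0) v) : Subgroup _) : Set _)) : ℂ)) *
          (νH.real (Function.support (hFamily L w hw ϖ 0)) : ℂ)))) :
      ∀ (L : Type) [Field L] [NumberField L] [IsCMField L]
        {v : HeightOneSpectrum (𝓞 ↥(maximalRealSubfield L))} (w : UnitaryGroup.PlacesOver L v)
        (hw : IsCMField.complexConj L • w.1 = w.1) (_he : v.asIdeal.ramificationIdx' w.1.asIdeal ≠ 1)
        (_h2 : ¬ IsUnit (2 : 𝒪[w.1.adicCompletion L]))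
        (ϖ : (w.1.adicCompletion L)) (_hϖ : Valued.v ϖ = WithZero.exp (-1 : ℤ)) (d tE : ℕ) (_hD : IsRamifiedQuadraticDatum (galAdicCompletionMap (L := L) (IsCMField.complexConj L) hw) ϖ d tE)
        [Fintype (Valued.ResidueField (w.1.adicCompletion L))] (δ : (w.1.adicCompletion L)) (_hδ : (galAdicCompletionMap (L := L) (IsCMField.complexConj L) hw) δ = -δ) (_hδ0 : δ ≠ 0)
        (μ : HeckeCharacter L) (_hμu : μ.IsUnitary)
        (_hμω : ∀ x : ideleGroup ↥(maximalRealSubfield L), μ (AdeleRing.ideleBaseChange ↥(maximalRealSubfield L) L x) = quadraticHeckeCharCM L x)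
        [MeasurableSpace ((UnitaryGroup.cmDatum L 3 (Matrix.of fun i j : Fin 3 => if i.val + j.val + 1 = 3 then (1 : L) else 0)).Local v)] [BorelSpace ((UnitaryGroup.cmDatum L 3 (Matrix.of fun i j : Fin 3 => if i.val + j.val + 1 = 3 then (1 : L) else 0)).Local v)]
        [∀ γ : ((UnitaryGroup.cmDatum L 3 (Matrix.of fun i j : Fin 3 => if i.val + j.val + 1 = 3 then (1 : L) else 0)).Local v), MeasurableSpace (((UnitaryGroup.cmDatum L 3 (Matrix.of fun i j : Fin 3 => if i.val + j.val + 1 = 3 then (1 : L) else 0)).Local v) ⧸ Subgroup.centralizer ({γ} : Set ((UnitaryGroup.cmDatum L 3 (Matrix.of fun i j : Fin 3 => if i.val + j.val + 1 = 3 then (1 : L) else 0)).Local v)))]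
        [∀ γ : ((UnitaryGroup.cmDatum L 3 (Matrix.of fun i j : Fin 3 => if i.val + j.val + 1 = 3 then (1 : L) else 0)).Local v), BorelSpace (((UnitaryGroup.cmDatum L 3 (Matrix.of fun i j : Fin 3 => if i.val + j.val + 1 = 3 then (1 : L) else 0)).Local v) ⧸ Subgroup.centralizer ({γ} : Set ((UnitaryGroup.cmDatum L 3 (Matrix.of fun i j : Fin 3 => if i.val + j.val + 1 = 3 then (1 : L) else 0)).Local v)))]
        [MeasurableSpace ((UnitaryGroup.cmDatum L 2 (Matrix.of fun i j : Fin 2 => if i.val + j.val + 1 = 2 then (1 : L) else 0)).Local v × (UnitaryGroup.cmDatum L 1 (Matrix.of fun i j : Fin 1 => if i.val + j.val + 1 = 1 then (1 : L) else 0)).Local v)] [BorelSpace ((UnitaryGroup.cmDatum L 2 (Matrix.of fun i j : Fin 2 => if i.val + j.val + 1 = 2 then (1 : L) else 0)).Local v × (UnitaryGroup.cmDatum L 1 (Matrix.of fun i j : Fin 1 => if i.val + j.val + 1 = 1 then (1 : L) else 0)).Local v)]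
        [∀ a : ((UnitaryGroup.cmDatum L 2 (Matrix.of fun i j : Fin 2 => if i.val + j.val + 1 = 2 then (1 : L) else 0)).Local v × (UnitaryGroup.cmDatum L 1 (Matrix.of fun i j : Fin 1 => if i.val + j.val + 1 = 1 then (1 : L) else 0)).Local v), MeasurableSpace (((UnitaryGroup.cmDatum L 2 (Matrix.of fun i j : Fin 2 => if i.val + j.val + 1 = 2 then (1 : L) else 0)).Local v × (UnitaryGroup.cmDatum L 1 (Matrix.of fun i j : Fin 1 => if i.val + j.val + 1 = 1 then (1 : L) else 0)).Local v) ⧸ Subgroup.centralizer ({a} : Set ((UnitaryGroup.cmDatum L 2 (Matrix.of fun i j : Fin 2 => if i.val + j.val + 1 = 2 then (1 : L) else 0)).Local v × (UnitaryGroup.cmDatum L 1 (Matrix.of fun i j : Fin 1 => if i.val + j.val + 1 = 1 then (1 : L) else 0)).Local v)))]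
        [∀ a : ((UnitaryGroup.cmDatum L 2 (Matrix.of fun i j : Fin 2 => if i.val + j.val + 1 = 2 then (1 : L) else 0)).Local v × (UnitaryGroup.cmDatum L 1 (Matrix.of fun i j : Fin 1 => if i.val + j.val + 1 = 1 then (1 : L) else 0)).Local v), BorelSpace (((UnitaryGroup.cmDatum L 2 (Matrix.of fun i j : Fin 2 => if i.val + j.val + 1 = 2 then (1 : L) else 0)).Local v × (UnitaryGroup.cmDatum L 1 (Matrix.of fun i j : Fin 1 => if i.val + j.val + 1 = 1 then (1 : L) else 0)).Local v) ⧸ Subgroup.centralizer ({a} : Set ((UnitaryGroup.cmDatum L 2 (Matrix.of fun i j : Fin 2 => if i.val + j.val + 1 = 2 then (1 : L) else 0)).Local v × (UnitaryGroup.cmDatum L 1 (Matrix.of fun i j : Fin 1 => if i.val + j.val + 1 = 1 then (1 : L) else 0)).Local v)))]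
        (νH : Measure ((UnitaryGroup.cmDatum L 2 (Matrix.of fun i j : Fin 2 => if i.val + j.val + 1 = 2 then (1 : L) else 0)).Local v × (UnitaryGroup.cmDatum L 1 (Matrix.of fun i j : Fin 1 => if i.val + j.val + 1 = 1 then (1 : L) else 0)).Local v)) [νH.IsHaarMeasure] [νH.IsMulRightInvariant]
        (νG₃ : Measure ((UnitaryGroup.cmDatum L 3 (Matrix.of fun i j : Fin 3 => if i.val + j.val + 1 = 3 then (1 : L) else 0)).Local v)) [νG₃.IsHaarMeasure] [νG₃.IsMulRightInvariant]
        (mH : OrbitalMeasureFamily ((UnitaryGroup.cmDatum L 2 (Matrix.of fun i j : Fin 2 => if i.val + j.val + 1 = 2 then (1 : L) else 0)).Local v × (UnitaryGroup.cmDatum L 1 (Matrix.of fun i j : Fin 1 => if i.val + j.val + 1 = 1 then (1 : L) else 0)).Local v)) (mG₃ : OrbitalMeasureFamily ((UnitaryGroup.cmDatum L 3 (Matrix.of fun i j : Fin 3 => if i.val + j.val + 1 = 3 then (1 : L) else 0)).Local v))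
        (_hmH : mH.IsCanonical (IsLocalGRegular L v) νH) (_hmG : mG₃.IsCanonical (fun γ => IsRegularElt (γ.val : GL (Fin 3) (UnitaryGroup.LocalRing L v))) νG₃),
        ∃ (r : ℕ) (ψ : Fin r → ((UnitaryGroup.cmDatum L 2 (Matrix.of fun i j : Fin 2 => if i.val + j.val + 1 = 2 then (1 : L) else 0)).Local v × (UnitaryGroup.cmDatum L 1 (Matrix.of fun i j : Fin 1 => if i.val + j.val + 1 = 1 then (1 : L) else 0)).Local v) → ℂ) (_ : ∀ s, IsLocSmooth (ψ s)) (coef : Fin r → ℂ),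
          -- ROW (1): the H-side realises THE κ-SIGNED LEVEL CENSUS OVER THE FOUR FRAMES `Γ_b` times the base transfer factor (no law pre-evaluated)
          (∃ V ∈ 𝓝 (1 : ((UnitaryGroup.cmDatum L 2 (Matrix.of fun i j : Fin 2 => if i.val + j.val + 1 = 2 then (1 : L) else 0)).Local v × (UnitaryGroup.cmDatum L 1 (Matrix.of fun i j : Fin 1 => if i.val + j.val + 1 = 1 then (1 : L) else 0)).Local v)), ∀ γH ∈ V, IsLocalGRegular L v γH →
            ∀ (f : Fin 4 → Fin 3 → (Fin 3 → (w.1.adicCompletion L))) (_hf : IsFourFrameFamily (galAdicCompletionMap (L := L) (IsCMField.complexConj L) hw) f)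
          (a b z : (w.1.adicCompletion L)) (_ha : a * (galAdicCompletionMap (L := L) (IsCMField.complexConj L) hw) a = 1) (_hb : b * (galAdicCompletionMap (L := L) (IsCMField.complexConj L) hw) b = 1) (_hz : z * (galAdicCompletionMap (L := L) (IsCMField.complexConj L) hw) z = 1)
          (_hzγ : z = finGammaTwo L v γH w) (_hra : ((((γH).1.val : GL (Fin 2) (UnitaryGroup.LocalRing L v)).val.map (Pi.evalRingHom (fun w' : UnitaryGroup.PlacesOver L v => w'.1.adicCompletion L) w))).charpoly.IsRoot (z * (a * a))) (_hrb : ((((γH).1.val : GL (Fin 2) (UnitaryGroup.LocalRing L v)).val.map (Pi.evalRingHom (fun w' : UnitaryGroup.PlacesOver L v => w'.1.adicCompletion L) w))).charpoly.IsRoot (z * (b * b)))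
          (_ha1 : Valued.v (a - 1) < Valued.v (2 : (w.1.adicCompletion L))) (_hb1 : Valued.v (b - 1) < Valued.v (2 : (w.1.adicCompletion L)))
          (n₁ n₂ n₃ : ℕ) (_hE : IsElementDatum (galAdicCompletionMap (L := L) (IsCMField.complexConj L) hw) ϖ (N₀ d) (a * a) (b * b) n₁ n₂ n₃)
          (k : ℕ) (_hk : 2 * k + d = n₁ + n₂ + n₃ + 2)
          (Γ : Fin 4 → GL (Fin 3) (w.1.adicCompletion L)) (_hΓ : ∀ b', (Γ b' : Matrix (Fin 3) (Fin 3) (w.1.adicCompletion L)) = frameElt (galAdicCompletionMap (L := L) (IsCMField.complexConj L) hw) f b' (a * a) (b * b))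
          (tb : Fin 4 → ((UnitaryGroup.cmDatum L 3 (Matrix.of fun i j : Fin 3 => if i.val + j.val + 1 = 3 then (1 : L) else 0)).Local v)) (_htb : ∀ b', ((((localNonsplitEquiv (IsCMField.complexConj L) (Matrix.of fun i j : Fin 3 => if i.val + j.val + 1 = 3 then (1 : L) else 0) (IsCMField.complexConj_ne_one L) w hw (tb b') :
                ↥(unitaryGroupOfForm (galAdicCompletionMap (L := L) (IsCMField.complexConj L) hw) (placeForm (Matrix.of fun i j : Fin 3 => if i.val + j.val + 1 = 3 then (1 : L) else 0) w.1))) : GL (Fin 3) (w.1.adicCompletion L)) : Matrix (Fin 3) (Fin 3) (w.1.adicCompletion L))) = z • (Γ b' : Matrix (Fin 3) (Fin 3) (w.1.adicCompletion L)))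
              (i : Fin 3) (B : ℤ), 2 * B = ((![n₁, n₂, n₃] : Fin 3 → ℕ) i : ℤ) - d + 2 - 2 * shift d tE →
              (∀ t' : ((UnitaryGroup.cmDatum L 3 (Matrix.of fun i j : Fin 3 => if i.val + j.val + 1 = 3 then (1 : L) else 0)).Local v), IsLocalNormPair L (Matrix.of fun i j : Fin 3 => if i.val + j.val + 1 = 3 then (1 : L) else 0) v γH t' ↔ ∃ b', ConjClasses.mk t' = ConjClasses.mk (tb b')) →
              (∀ b' : Fin 4, ((finExplicitCollection L (Matrix.of fun i j : Fin 3 => if i.val + j.val + 1 = 3 then (1 : L) else 0) μ (finExplicitDelta_conj_left_all L (Matrix.of fun i j : Fin 3 => if i.val + j.val + 1 = 3 then (1 : L) else 0) μ) (finExplicitDelta_conj_right_all L (Matrix.of fun i j : Fin 3 => if i.val + j.val + 1 = 3 then (1 : L) else 0) μ)) v).Δ γH (tb b') = ((finExplicitCollection L (Matrix.of fun i j : Fin 3 => if i.val + j.val + 1 = 3 then (1 : L) else 0) μ (finExplicitDelta_conj_left_all L (Matrix.of fun i j : Fin 3 => if i.val + j.val + 1 = 3 then (1 : L) else 0) μ)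 (finExplicitDelta_conj_right_all L (Matrix.of fun i j : Fin 3 => if i.val + j.val + 1 = 3 then (1 : L) else 0) μ)) v).Δ γH (tb 0) * (kappaChar i b' : ℂ)) →
              ∑ s, coef s * stableOrbitalIntegralRel (IsLocalStablyConjH L v) mH (ψ s) γH =
                ((finExplicitCollection L (Matrix.of fun i j : Fin 3 => if i.val + j.val + 1 = 3 then (1 : L) else 0) μ (finExplicitDelta_conj_left_all L (Matrix.of fun i j : Fin 3 => if i.val + j.val + 1 = 3 then (1 : L) else 0) μ) (finExplicitDelta_conj_right_all L (Matrix.of fun i j : Fin 3 => if i.val + j.val + 1 = 3 then (1 : L) else 0) μ)) v).Δ γH (tb 0) * ((νG₃ (cmLocalIntegralLevel L 3 (Matrix.of fun i j : Fin 3 => if i.val + j.val + 1 = 3 then (1 : L) else 0) v : Set ((UnitaryGroup.cmDatum L 3 (Matrix.of fun i j : Fin 3 => if i.val + j.val + 1 = 3 then (1 : L) else 0)).Local v))).toReal : ℂ) *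
                  (((Ω (w.1.adicCompletion L) (galAdicCompletionMap (L := L) (IsCMField.complexConj L) hw) ϖ d a b i * (baseSign (galAdicCompletionMap (L := L) (IsCMField.complexConj L) hw) i * normSign (galAdicCompletionMap (L := L) (IsCMField.complexConj L) hw) (fPartProd δ ![a, b, 1] i)) : ℤ) : ℂ) *
                    ((A (Fintype.card (Valued.ResidueField (w.1.adicCompletion L))) d tE k B : ℚ) : ℂ))) ∧
          -- ROW (2), type (2), transfer-shaped (law debt)
          (∃ V ∈ 𝓝 (1 : ((UnitaryGroup.cmDatum L 2 (Matrix.of fun i j : Fin 2 => if i.val + j.val + 1 = 2 then (1 : L) else 0)).Local v × (UnitaryGroup.cmDatum L 1 (Matrix.of fun i j : Fin 1 => if i.val + j.val + 1 = 1 then (1 : L) else 0)).Local v)), ∀ γH ∈ V, IsLocalGRegular L v γH →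
          ¬ (∃ x : (w.1.adicCompletion L), (((((γH).1.val : GL (Fin 2) (UnitaryGroup.LocalRing L v)).val.map (Pi.evalRingHom (fun w' : UnitaryGroup.PlacesOver L v => w'.1.adicCompletion L) w))).charpoly).IsRoot x) →
          ∑ᶠ c : ConjClasses ((UnitaryGroup.cmDatum L 3 (Matrix.of fun i j : Fin 3 => if i.val + j.val + 1 = 3 then (1 : L) else 0)).Local v), ((finExplicitCollection L (Matrix.of fun i j : Fin 3 => if i.val + j.val + 1 = 3 then (1 : L) else 0) μ (finExplicitDelta_conj_left_all L (Matrix.of fun i j : Fin 3 => if i.val + j.val + 1 = 3 then (1 : L) else 0) μ) (finExplicitDelta_conj_right_all L (Matrix.of fun i j : Fin 3 => if i.val + j.val + 1 = 3 then (1 : L) else 0) μ)) v).Δ γH (Quotient.out c) * classOrbitalIntegral mG₃ 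
            (Set.indicator {u : ((UnitaryGroup.cmDatum L 3 (Matrix.of fun i j : Fin 3 => if i.val + j.val + 1 = 3 then (1 : L) else 0)).Local v) |
            u ∈ cmLocalIntegralLevel L 3 (Matrix.of fun i j : Fin 3 => if i.val + j.val + 1 = 3 then (1 : L) else 0) v ∧
            InLevel ϖ (ℓb (dOfPlace L v w)) ((wMatrix L w hw u - 1) * (wMatrix L w hw u - 1))} (fun _ => (1 : ℂ))) c =
            ∑ s, coef s * stableOrbitalIntegralRel (IsLocalStablyConjH L v) mH (ψ s) γH) ∧
          -- ROW (3), Levi, transfer-shaped (law debt)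
          (∃ V ∈ 𝓝 (1 : ((UnitaryGroup.cmDatum L 2 (Matrix.of fun i j : Fin 2 => if i.val + j.val + 1 = 2 then (1 : L) else 0)).Local v × (UnitaryGroup.cmDatum L 1 (Matrix.of fun i j : Fin 1 => if i.val + j.val + 1 = 1 then (1 : L) else 0)).Local v)), ∀ γH ∈ V, IsLocalGRegular L v γH →
          (∃ (y : ((UnitaryGroup.cmDatum L 2 (Matrix.of fun i j : Fin 2 => if i.val + j.val + 1 = 2 then (1 : L) else 0)).Local v × (UnitaryGroup.cmDatum L 1 (Matrix.of fun i j : Fin 1 => if i.val + j.val + 1 = 1 then (1 : L) else 0)).Local v)) (d' : Fin 2 → (UnitaryGroup.LocalRing L v)ˣ),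
              glDiagonal 2 (UnitaryGroup.LocalRing L v) d' = ((y * γH * y⁻¹).1.val : GL (Fin 2) (UnitaryGroup.LocalRing L v))) →
          ∑ᶠ c : ConjClasses ((UnitaryGroup.cmDatum L 3 (Matrix.of fun i j : Fin 3 => if i.val + j.val + 1 = 3 then (1 : L) else 0)).Local v), ((finExplicitCollection L (Matrix.of fun i j : Fin 3 => if i.val + j.val + 1 = 3 then (1 : L) else 0) μ (finExplicitDelta_conj_left_all L (Matrix.of fun i j : Fin 3 => if i.val + j.val + 1 = 3 then (1 : L) else 0) μ) (finExplicitDelta_conj_right_all L (Matrix.of fun i j : Fin 3 => if i.val + j.val + 1 = 3 then (1 : L) else 0) μ)) v).Δ γH (Quotient.out c) * classOrbitalIntegral mG₃ 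
            (Set.indicator {u : ((UnitaryGroup.cmDatum L 3 (Matrix.of fun i j : Fin 3 => if i.val + j.val + 1 = 3 then (1 : L) else 0)).Local v) |
            u ∈ cmLocalIntegralLevel L 3 (Matrix.of fun i j : Fin 3 => if i.val + j.val + 1 = 3 then (1 : L) else 0) v ∧
            InLevel ϖ (ℓb (dOfPlace L v w)) ((wMatrix L w hw u - 1) * (wMatrix L w hw u - 1))} (fun _ => (1 : ℂ))) c =
            ∑ s, coef s * stableOrbitalIntegralRel (IsLocalStablyConjH L v) mH (ψ s) γH) := by
  intro L _i1 _i2 _i3 v w hw he h2u ϖ hϖ d tE hD _iF δ hδ hδ0 μ hμu hμω _i4 _i5 _i6 _i7 _i8 _i9 _i10 _i11 νH _i12 _i13 νG₃ _i14 _i15 mH mG₃ hmH hmG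
  obtain ⟨cA, cB, N₁, hA, hG, hnum⟩ := hrows L w hw he h2u ϖ hϖ d tE hD δ hδ hδ0 μ hμu hμω νH νG₃ mH mG₃ hmH hmG
  refine ⟨2, hFamily L w hw ϖ, fun s => isLocSmooth_hFamily L w hw he ϖ hϖ s, (fun s : Fin 2 => if ((s : Fin 2) : ℕ) = d % 2 then (cA + cB) / (2 * (νH.real (Function.support (hFamily L w hw ϖ s)) : ℂ)) else -cB / (2 * (νH.real (Function.support (hFamily L w hw ϖ s)) : ℂ))), ?_, ?_, ?_⟩
  · -- ROW (1)
    exact rowOne_of_hSideIdentity_token shift Ω N₀ A L w hw he h2u ϖ hϖ d tE hD δ hδ hδ0 μ hμu hμω νH νG₃ mH mG₃ hmH hmG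
      ((νG₃ (cmLocalIntegralLevel L 3 (Matrix.of fun i j : Fin 3 => if i.val + j.val + 1 = 3 then (1 : L) else 0) v : Set ((UnitaryGroup.cmDatum L 3 (Matrix.of fun i j : Fin 3 => if i.val + j.val + 1 = 3 then (1 : L) else 0)).Local v))).toReal : ℂ) (hFamily L w hw ϖ) (fun s : Fin 2 => if ((s : Fin 2) : ℕ) = d % 2 then (cA + cB) / (2 * (νH.real (Function.support (hFamily L w hw ϖ s)) : ℂ)) else -cB / (2 * (νH.real (Function.support (hFamily L w hw ϖ s)) : ℂ)))
      (hSideIdentity_hFamily_coefAffine_of_affine_token shift Ω N₀ A L w hw he h2u ϖ hϖ d tE hD δ hδ hδ0 μ hμu hμω νH νG₃ mH mG₃ hmH hmG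
        ((νG₃ (cmLocalIntegralLevel L 3 (Matrix.of fun i j : Fin 3 => if i.val + j.val + 1 = 3 then (1 : L) else 0) v : Set ((UnitaryGroup.cmDatum L 3 (Matrix.of fun i j : Fin 3 => if i.val + j.val + 1 = 3 then (1 : L) else 0)).Local v))).toReal : ℂ) cA cB N₁ hA)
  · -- ROW (2): ★ (V6) at the square-level piece
    exact rowTwo_of_gSide_hFamily L w hw he h2u ϖ hϖ d tE hD μ νH mH mG₃ hmH
      (Set.indicator {u : ((UnitaryGroup.cmDatum L 3 (Matrix.of fun i j : Fin 3 => if i.val + j.val + 1 = 3 then (1 : L) else 0)).Local v) | u ∈ cmLocalIntegralLevel L 3 (Matrix.of fun i j : Fin 3 => if i.val + j.val + 1 = 3 then (1 : L) else 0) v ∧ InLevel ϖ (ℓb (dOfPlace L v w)) ((wMatrix L w hw u - 1) * (wMatrix L w hw u - 1))} (fun _ => (1 : ℂ)))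
      (fun s : Fin 2 => if ((s : Fin 2) : ℕ) = d % 2 then (cA + cB) / (2 * (νH.real (Function.support (hFamily L w hw ϖ s)) : ℂ)) else -cB / (2 * (νH.real (Function.support (hFamily L w hw ϖ s)) : ℂ))) hG
  · -- ROW (3): ★ (V5-lev) at `(0, ℓb (dOfPlace))`, then the piece identity §1
    letI : MeasurableSpace ↥(unitaryGroupOfForm (conjLocal L (IsCMField.complexConj L) v) (cmLocalForm L 3 v)) :=
      (inferInstance : MeasurableSpace ((UnitaryGroup.cmDatum L 3 (Matrix.of fun i j : Fin 3 => if i.val + j.val + 1 = 3 then (1 : L) else 0)).Local v))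
    haveI : BorelSpace ↥(unitaryGroupOfForm (conjLocal L (IsCMField.complexConj L) v) (cmLocalForm L 3 v)) :=
      (inferInstance : BorelSpace ((UnitaryGroup.cmDatum L 3 (Matrix.of fun i j : Fin 3 => if i.val + j.val + 1 = 3 then (1 : L) else 0)).Local v))
    obtain ⟨μN, hμN, hσN⟩ := exists_isHaarMeasure_sFinite_unipotentU L 3 v
    haveI := hμN
    haveI := hσN
    have hd : dOfPlace L v w = d := dOfPlace_eq_of_isRamifiedQuadraticDatum L w hw he hD
    obtain ⟨-, -, -, -, -, h1d, -⟩ := id hD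
    have hb' : ℓb (dOfPlace L v w) ≤ mstarFn L v w := by
      show ℓb (dOfPlace L v w) ≤ mstarOfRecord (dOfPlace L v w); rw [hd]; exact hb d h1d
    have h3 := rowThree_levels_hFamily_of_scalar L w hw he h2u ϖ hϖ d tE hD 0 (ℓb (dOfPlace L v w)) (Nat.zero_le _) hb' μ hμω νH νG₃ hmH hmG μN
      (fun s : Fin 2 => if ((s : Fin 2) : ℕ) = d % 2 then (cA + cB) / (2 * (νH.real (Function.support (hFamily L w hw ϖ s)) : ℂ)) else -cB / (2 * (νH.real (Function.support (hFamily L w hw ϖ s)) : ℂ))) hnum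
    rw [indicator_levels_zero_eq_sqLevel L w hw ϖ (ℓb (dOfPlace L v w))] at h3
    exact h3

end Summit.HodgeConjecture.HodgeConjecture.Cruxes.H413.F0P3cDyRamHSideSqOfHFamilyRowsGuarded

end
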